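import Literature.Topology.FourManifolds.CircleSurgery
import HarnessLib

/-!
# Surgered mapping tori of based diffeomorphisms of closed 3-manifolds
# (4-dimensional open books with binding `S²`, framing-free)

Statement layer (T0, definitions only). Gompf, *More Cappell–Shaneson spheres are standard*,
Algebr. Geom. Topol. 10 (2010), §2, first paragraph, defines for ANY closed 3-manifold `M`, any
diffeomorphism `φ` of `M` and any fixed point `p` of `φ` the mapping torus `X_φ` and the two
4-manifolds `X_φ^ε` obtained by surgery on the section circle `ℝ × {p} ⊂ X_φ` (the two framings
`ε`); "the Cappell–Shaneson examples arise when `M` is the 3-torus". The tree's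
`Literature.Topology.FourManifolds.IsSurgeredMappingTorusOf φ X` (`SurgeredMappingTorus.lean`) is
this construction for `M = T³`, `p = 1`; the present file records the same body for an arbitrary
page `F` (a 3-manifold charted on `ℝ³`) and base point `x₀`:
`Literature.Topology.FourManifolds.IsSurgeredMappingTorusAt φ x₀ X`.

Equivalent classical language (Aitchison–Rubinstein, *Fibered knots and involutions on homotopy
spheres*, in: Four-Manifold Theory (Durham 1982), Contemp. Math. 35 (1984), §2, Definition and
Theorem 2.1): a closed 4-manifold is an *open book with binding `S²`* — equivalently contains a
*fibred 2-knot* — iff it is `E_ρ ∪ (S² × D²)` for the mapping torus `E_ρ` of a diffeomorphism `ρ`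
of a compact 3-manifold `M₀` with `∂M₀ = S²` restricting to the identity near the boundary;
closing the page by a ball (`M = M₀ ∪ B³`, `ρ` extended by the identity, `p` = centre of the
ball) identifies `E_ρ ∪ (S² × D²)` with one of Gompf's `X_ρ^ε`, the other value of `ε` being the
Gluck twist of the 4-manifold on the fibred 2-knot `S² × {0}`. Conversely, for a based
diffeomorphism `φ`, `φ x₀ = x₀`, an isotopy of `φ` rel `x₀` to a diffeomorphism fixing a ball
about `x₀` (linearise at `x₀`, `GL⁺(3, ℝ)` is connected; an orientation-reversing `φ` gives a
non-orientable `X_φ`, irrelevant for homotopy spheres) does not change `X_φ^ε` (based-isotopy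
invariance, proved in the tree for `T³` as
`Literature.Topology.FourManifolds.isSurgeredMappingTorusOf_congr_of_isDiffeotopicToIdRel`). So
the 4-manifolds `X` with `IsSurgeredMappingTorusAt φ x₀ X` for some `(F, φ, x₀)` are exactly the
closed 4-manifolds containing a fibred 2-knot, together with their Gluck twists on such knots
(which again contain the fibred 2-knot `S² × {0}`): the "fibred class".

Design (as in `CircleSurgery.lean`, `SurgeredMappingTorus.lean`): the page `F` is charted on the
fixed model `EuclideanSpace ℝ (Fin 3)` with `𝓡 3` (no model-generality: cf. the refuted transport
artefacts recorded in `MappingTorusTransportCounterexample.lean`), the mapping torus is presented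
by explicit gluing witnesses `IsOpenGluingWith` of the cylinders `F × (0, 1)`, `F × (1/2, 3/2)`
along `mappingTorusRel φ` so that the section circle can be NAMED as
`jA ({x₀} × (0, 1)) ∪ jB ({x₀} × (1/2, 3/2))`, and the surgery is `IsCircleSurgery` with the
tubular neighbourhood (hence the framing) unspecified. The predicate only needs `X` as a charted
space; Hausdorffness, second countability and smoothness of `X` are asserted where `X` is
produced or consumed (route `Summits/SmoothPoincare4/SmoothPoincare4/Theses/FibredPageGeometrization`).

## References

* R. E. Gompf, *More Cappell–Shaneson spheres are standard*, Algebr. Geom. Topol. 10 (2010)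
  1665–1681, doi:10.2140/agt.2010.10.1665, §2 (definition of `X_φ`, `C = ℝ × {p}`, `X_φ^ε`).
  [GompfAGT2010]
* I. R. Aitchison, J. H. Rubinstein, *Fibered knots and involutions on homotopy spheres*, in
  Four-Manifold Theory, Contemp. Math. 35, AMS (1984) 1–74, §2 (open books with binding `S²` =
  fibred 2-knots; Theorem 2.1). [AitchisonRubinstein1984]
* S. P. Plotnick, *Fibered knots in `S⁴` — twisting, spinning, rolling, surgery, and branching*,
  ibid. 437–459 (the gluings `P ∪ X × S¹`). [Plotnick1984]
-/

open scoped Manifold ContDiff Topology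
open Set Function

noncomputable section

namespace Literature.Topology.FourManifolds

section Predicate

variable {F : Type*} [TopologicalSpace F] [ChartedSpace (EuclideanSpace ℝ (Fin 3)) F]

/-- **Surgered mapping torus of a based diffeomorphism of a 3-manifold** (Gompf's `X_φ^ε` for a
general page, framing `ε` unspecified; equivalently: 4-manifolds with a fibred 2-knot of closed
fibre `F` and closed monodromy `φ`, and their Gluck twists). For a 3-manifold `F` charted on `ℝ³`,
a diffeomorphism `φ : F ≃ₘ F` and a point `x₀ : F`, `IsSurgeredMappingTorusAt φ x₀ X` says that
`φ x₀ = x₀` and that the 4-manifold `X` (charted on `ℝ⁴`) is obtained from a closed smooth mapping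
torus `T` of `φ` — a compact Hausdorff second-countable `C^∞` 4-manifold glued from the cylinders
`F × (0, 1)` and `F × (1/2, 3/2)` by open embeddings `jA`, `jB` along `mappingTorusRel φ`,
`(x, s) ∼ (φ x, s + 1)` (`IsOpenGluingWith`) — by surgery (`IsCircleSurgery`, any tubular
neighbourhood, hence either framing) on the *section circle through `x₀`*: a smoothly embedded
circle `c : 𝕊¹ → T` with image `jA ({x₀} × (0, 1)) ∪ jB ({x₀} × (1/2, 3/2))` (a circle since
`φ x₀ = x₀`). This is verbatim the body of `IsSurgeredMappingTorusOf` (page `T³ = ThreeTorus`,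
base point `1`) with an arbitrary page and base point: Gompf 2010, §2, first paragraph ("Let `X_φ`
be the mapping torus `ℝ × M / (t, x) ∼ (t - 1, φ(x))`. Then `ℝ × {p}` descends to a circle
`C ⊂ X_φ` … let `X_φ^ε` be obtained from `X_φ` by surgery on `C`"), for `M = F`, `p = x₀`, both
values of `ε` allowed; Aitchison–Rubinstein 1984, §2 (open book with binding `S²` / fibred
2-knot). Convention: the tree's relation `(x, s) ∼ (φ x, s + 1)` is Gompf's `X_{φ⁻¹}`.
[cite: GompfAGT2010, §2 (definition of X_φ and X_φ^ε)] -/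
def IsSurgeredMappingTorusAt (φ : F ≃ₘ⟮𝓡 3, 𝓡 3⟯ F) (x₀ : F) (X : Type*) [TopologicalSpace X]
    [ChartedSpace (EuclideanSpace ℝ (Fin 4)) X] : Prop :=
  φ x₀ = x₀ ∧
    ∃ (T : Type) (_ : TopologicalSpace T) (_ : T2Space T) (_ : SecondCountableTopology T)
      (_ : CompactSpace T) (_ : ChartedSpace (EuclideanSpace ℝ (Fin 4)) T) (_ : IsManifold (𝓡 4) ∞ T)
      (jA : F × ↥mappingTorusPieceOne → T) (jB : F × ↥mappingTorusPieceTwo → T),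
      IsOpenGluingWith ((𝓡 3).prod 𝓘(ℝ, ℝ)) ((𝓡 3).prod 𝓘(ℝ, ℝ)) (𝓡 4)
          (mappingTorusRel ⇑φ) jA jB ∧
        ∃ c : (Metric.sphere (0 : EuclideanSpace ℝ (Fin 2)) 1) → T, Manifold.IsSmoothEmbedding (𝓡 1) (𝓡 4) ∞ c ∧
          Set.range c = jA '' ({x₀} ×ˢ Set.univ) ∪ jB '' ({x₀} ×ˢ Set.univ) ∧
          IsCircleSurgery (𝓡 4) (𝓡 4) T X c

/-- The base point of a surgered mapping torus is fixed by the monodromy (first clause of the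
definition; Gompf 2010, §2: "`p` a fixed point of `φ`"). [cite: GompfAGT2010, §2 (definition of X_φ and X_φ^ε)] -/
theorem IsSurgeredMappingTorusAt.apply_basePoint {φ : F ≃ₘ⟮𝓡 3, 𝓡 3⟯ F} {x₀ : F} {X : Type*}
    [TopologicalSpace X] [ChartedSpace (EuclideanSpace ℝ (Fin 4)) X] (h : IsSurgeredMappingTorusAt φ x₀ X) :
    φ x₀ = x₀ :=
  h.1

/-- **Bridge to the accepted mapping torus predicate.** A surgered mapping torus of `φ` at `x₀`
is obtained by circle surgery on a smoothly embedded circle in *a* closed smooth mapping torus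
(`IsMappingTorusOf (𝓡 4) T φ`) of `φ` (forget the gluing witnesses via `isOpenGluing_iff`; Gompf
2010, §2; the `T³` case is `IsCappellShanesonSphereOf.exists_isMappingTorusOf`). [cite: GompfAGT2010, §2 (definition of X_φ and X_φ^ε)] -/
theorem IsSurgeredMappingTorusAt.exists_isMappingTorusOf {φ : F ≃ₘ⟮𝓡 3, 𝓡 3⟯ F} {x₀ : F}
    {X : Type*} [TopologicalSpace X] [ChartedSpace (EuclideanSpace ℝ (Fin 4)) X]
    (h : IsSurgeredMappingTorusAt φ x₀ X) :
    ∃ (T : Type) (_ : TopologicalSpace T) (_ : T2Space T) (_ : SecondCountableTopology T)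
      (_ : CompactSpace T) (_ : ChartedSpace (EuclideanSpace ℝ (Fin 4)) T) (_ : IsManifold (𝓡 4) ∞ T),
      IsMappingTorusOf (𝓡 4) T φ ∧
        ∃ c : (Metric.sphere (0 : EuclideanSpace ℝ (Fin 2)) 1) → T, Manifold.IsSmoothEmbedding (𝓡 1) (𝓡 4) ∞ c ∧
          IsCircleSurgery (𝓡 4) (𝓡 4) T X c := by
  obtain ⟨-, T, _, _, _, _, _, _, jA, jB, hG, c, hc, -, hX⟩ := h
  refine ⟨T, ‹_›, ‹_›, ‹_›, ‹_›, ‹_›, ‹_›, ?_, c, hc, hX⟩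
  exact hG.isOpenGluing

end Predicate

end Literature.Topology.FourManifolds
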